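import Literature.MathematicalPhysics.QuantumFieldTheory.Balaban1983to89.B9LettersZQstarFieldsAtPinsR
import Literature.MathematicalPhysics.QuantumFieldTheory.Balaban1983to89.B9BackgroundsKLevelV1R
import Literature.MathematicalPhysics.QuantumFieldTheory.Balaban1983to89.Node00.OpsYRecordV4P
import Literature.MathematicalPhysics.QuantumFieldTheory.Balaban1983to89.B9LettersHZAtOne
import Literature.MathematicalPhysics.QuantumFieldTheory.Balaban1983to89.B9Thm33G0ProbeZeroAtCutPins
import Literature.MathematicalPhysics.QuantumFieldTheory.Balaban1983to89.B9RWSums347DefiniteFaces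
import Literature.MathematicalPhysics.QuantumFieldTheory.Balaban1983to89.B9Eq3132TentKinetic

/-!
# BalabanUVNodes ∕ N06 ([B9], `Dag.B9_main`) — THE DISPLAYED `G₀Q\*` AND `Φ^X_βG₀Q\*` LETTERS ON THE TRANSFERRED CLASS `Z_{len·n⁻¹}` (`hZ2`.2 = `gQs1`, `hpXQs` of the
# stage-11 certificate) DERIVED AT THE PINS from the certificate's own G₀ layer (`Thm33G0.e0`, `Thm33G0Dir.e1d` at rate δ12₀), its probe ∕ direction ∕ `Q\*` pins and ONE
# STRICT budget line `δ12₃ < δ12₀` — member-uniformly, with produced threshold and constants, at rate δ12₃; the [4] (2.60) member facts are DISCHARGED inside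

Track A of `YM-PLAN.md` (cell `pub-ymgap`, HUMAN RULING D-0062), node **N06** = [Balaban1985BackgroundPropagators] Thms 3.1–3.15; bundle F7 rows 20–21, seat `pub-ymgap-dag-n06-l`
(g31); memo `DISPLAY-LEDGER-ROWS2021.md` §2 (the G₀Q\* family) and §5 (last row: what editions ≥ 81 still display); dag-n06-d's word (t3) «GO on gQs1 ∕ hpXQs» (cell INBOX
2026-08-29 18:48Z).  A HELPER for dag-n06-d's certificate editions after ED.81 «UH» ∕ ED.83 «UJ».
WHY.  Editions ≥ 81 display `hZ2 : … (G₀∇_U : 𝔠_W⁽¹⁾ → 𝔠⁽²⁾) ∧ HasMaj Z_{len·n⁻¹} 𝔠⁽¹⁾ (G₀∘Q\*) (B12₃e^{−δ12₃d})` and `hpXQs : … ∀ β, HasMaj Z_{len·n⁻¹} 𝔠_P^{(β−1)} (Φ^X_β∘G₀∘Q\*)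
(Bx13 β·e^{−δ12₃d})` (readers: the state layer `hStateTuples_of_pinsP_geo9Y`, the `Letters313HZ` record, the rows face `…StateSUC`), although they DERIVE the G₀ layer
(`g0_layer_of_thm310_coreDir₃US`: `hmodel12 ….1 : Thm33G0 …` with field `e0` = the (3.42)₀ letter `B12₀·len²·e^{−δ12₀d}`, `hG0C ….1 : Thm33G0Dir …` with field `e1d`) and hold
the pins `hQsco12` (Q\*), `h𝔭A` (Hölder probes = the `Adm`-cut carrier `holderProbesKA`), `h𝔡Ad` (directional covariant derivative), `hlev ∕ hβ1` (block map laws).  Both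
displayed letters are G₀ letters composed with the LOCAL letter of `Q\*` (dag-n06-w5 `hasMaj_Qstar_of_pins`) after ONE p.-398 scale transfer `Z_{n⁻¹} → Z_{len·n⁻¹}`
([4] (2.60) at exponent α, cost `α·δ_F` in the rate): dag-n06-l's carrier-generic twins `B9LettersZQstarFieldsAtPinsR.gQs1_pinsB ∕ pXQs_pinsB` (p734944) give them from `e0`,
resp. from the probe-zero face `pX0` of `Φ^X_β∘G₀` (dag-n06-w6 `B9Thm33G0ProbeZeroAtCutPins.pX0_of_pins`, itself from `e0 + e1d` at the cut pin — constant β-INDEPENDENT), a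
`Facts347` witness and a row sum.  THIS FILE discharges the member facts at the geometry of record (`B9RWSums347DefiniteFaces.facts347_exp261_geo9Y` with `α := ½`,
`δ_F := 2(δ12₀ − δ12₃) > 0`, `L₀ := ℓ+1`, above a produced threshold), the row sum by `rowSum261_geo9Y` at rate 1, reads «`U` is SU(N)-valued» off the class axiom
(`mem_of_reg335R hGR`), and packages everything in the certificate's binder shapes: ★★★ `g0qstar_transfer_letters_of_pins` — ∃ `Mz ≥ M12`, `Bz ≥ 0`, `Bxz ≥ 0` such that above
`Mz` the `gQs1`-letter holds at `(Bz, δ12₃)` and the `pXQs`-family at `(Bxz, δ12₃)` for every `0 ≤ β < 1` (SAME constant for all β).  Budget: the transfer needs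
`δ12₃ ≤ δ12₀ − α·δ_F`, i.e. exactly the STRICT line `hδ₃₀ : δ12₃ < δ12₀` (the certificate's `δ12₃ ≤ δ12₀` retyped strict); no other numeric.  The knit: `hZ2 ↦ hZ1 = ⟨gD2⟩`,
`hpXQs` leaves, and — `Bxz` being β-independent — `Bx13 := fun _ => Bxz`, `Bx13₀ := Bxz`, `hwBx13` by `wX ≤ 1` become derivable as well (dag-n06-d's pen).
HONEST FRAMING.  By-name composition of kernel-checked helper files; the G₀-layer letters `he0 ∕ he1d` are HYPOTHESES (the certificate's derived layer); COUNT-NEUTRAL; nothing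
of [B9]'s propagator estimates asserted; N06 NOT discharged; K1 NOT closed; one finite 𝕋⁴ programme at fixed `ε` — NOT continuum, NOT OS, NOT the mass gap ∕ Clay.
0 `def`, 0 `sorry`.
-/

noncomputable section

namespace Summit.QuantumFields.YangMills.BalabanUVNodes.N06G0QstarTransferLegAtPinsPU

open scoped Matrix.Norms.L2Operator
open Literature.MathematicalPhysics.QuantumFieldTheory.Balaban1983to89
open Literature.MathematicalPhysics.QuantumFieldTheory.Balaban1983to89.Node00
open Literature.MathematicalPhysics.QuantumFieldTheory.Balaban1983to89.B9PinMembersKLevelV1 (MemberY geo9Y bg9Y)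
open Literature.MathematicalPhysics.QuantumFieldTheory.Balaban1983to89.B9BackgroundsKLevelV1R (RegFamY bg9YR MemOfFam mem_of_reg335R)
open Literature.MathematicalPhysics.QuantumFieldTheory.Balaban1983to89.B7Prop2SpecialUnitary (specialUnitaryUnits specialUnitaryUnits_le_unitaryUnits)
open Literature.MathematicalPhysics.QuantumFieldTheory.Balaban1983to89.B6GlobalChartV1 (blkV1)
open Literature.MathematicalPhysics.QuantumFieldTheory.Balaban1983to89.B6Ineq2142KLevelV1 (β lvl)
open Literature.MathematicalPhysics.QuantumFieldTheory.Balaban1983to89.B6Geom246MultiLevelTorus (geomT)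
open Literature.MathematicalPhysics.QuantumFieldTheory.Balaban1983to89.B6RandomWalk (HasMajorant)
open Literature.MathematicalPhysics.QuantumFieldTheory.Balaban1983to89.B6RandomWalkHom (HasMajorantHom)
open Literature.MathematicalPhysics.QuantumFieldTheory.Balaban1983to89.B9CoReadingCoordsTranspose (TrIdx trBasis)
open Literature.MathematicalPhysics.QuantumFieldTheory.Balaban1983to89.B9CoReadingCoords (coordOpK XBK blkBK cdBₗ)
open Literature.MathematicalPhysics.QuantumFieldTheory.Balaban1983to89.B9CoReadingCoordsH (XHK blkHK)
open Literature.MathematicalPhysics.QuantumFieldTheory.Balaban1983to89.B9CoReadingCoordsHolder (PK)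
open Literature.MathematicalPhysics.QuantumFieldTheory.Balaban1983to89.B9CoReadingCoordsHolderAdm (holderProbesKA)
open Literature.MathematicalPhysics.QuantumFieldTheory.Balaban1983to89.B9Thm39ReadingCoords (coordBound39 basisBound39)
open Literature.MathematicalPhysics.QuantumFieldTheory.Balaban1983to89.B9GeoNormsKLevelV1 (geo9K geo9K_dist_nonneg)
open Literature.MathematicalPhysics.QuantumFieldTheory.Balaban1983to89.B9GeoLemma21KLevelV1 (geo9Y_dist_triangle geo9Y_dist_comm geo9Y_len_pos rowSum261_geo9Y)
open Literature.MathematicalPhysics.QuantumFieldTheory.Balaban1983to89.B9Thm34Ext (toB6)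
open Literature.MathematicalPhysics.QuantumFieldTheory.Balaban1983to89.B9SectDSup (weightNorm)
open Literature.MathematicalPhysics.QuantumFieldTheory.Balaban1983to89.B11SectG (HasMaj BlockNorm RowSum)
open Literature.MathematicalPhysics.QuantumFieldTheory.Balaban1983to89.B9Thm312Whole (Ops GeoOK cNorm)
open Literature.MathematicalPhysics.QuantumFieldTheory.Balaban1983to89.B9Thm312WholeClasses (cNormR)
open Literature.MathematicalPhysics.QuantumFieldTheory.Balaban1983to89.B9RWSums343Holder (HolderProbes)
open Literature.MathematicalPhysics.QuantumFieldTheory.Balaban1983to89.B9RWSums343to347Whole (Facts347)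
open Literature.MathematicalPhysics.QuantumFieldTheory.Balaban1983to89.B9RWSums347DefiniteFaces (exp261 facts347_exp261_geo9Y)
open Literature.MathematicalPhysics.QuantumFieldTheory.Balaban1983to89.B9LettersHZAtOne (plateau_pos)
open Literature.MathematicalPhysics.QuantumFieldTheory.Balaban1983to89.Node00.OpsYSectDCoords (QscoKH)
open Literature.MathematicalPhysics.QuantumFieldTheory.Balaban1983to89.B9Thm33G0ProbeZeroAtCutPins (pX0_of_pins)
open Literature.MathematicalPhysics.QuantumFieldTheory.Balaban1983to89.B9LettersZQstarFieldsAtPinsR (gQs1_pinsB pXQs_pinsB)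

variable {N : ℕ}

/-- ★★★ **`G₀Q\*` INTO `𝔠⁽¹⁾` AND `Φ^X_βG₀Q\*` INTO `𝔠_P^{(β−1)}` OUT OF `Z_{len·n⁻¹}` AT THE PINS, MemberY θ.d₆ θ.ℓ₆ θ.hd' θ.hL' θ.b₀ θ.b₁ MstarBER-UNIFORMLY, FROM THE G₀ LAYER** (module docstring): from the
(3.42)₀ letter `e0` of G₀ and the directional letters `e1d` of ∇_{U,ν}G₀ at (B12₀, δ12₀), the block-map laws `hlev ∕ hβ1`, the probe pin `h𝔭A` (cut carrier, transporter
`parB = parBY`), the direction pin `hDd`, the block maps and the pin of Q\*, and the STRICT budget `δ12₃ < δ12₀`, ONE `obtain` gives `Mz ≥ M12`, `Bz ≥ 0`, `Bxz ≥ 0` and the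
certificate's `hZ2`.2 (`gQs1`) at `(Bz, δ12₃)` and `hpXQs` at `(Bxz, δ12₃)` (all `0 ≤ β < 1`, one constant).  Inside: `Facts347` at `α := ½`, `δ_F := 2(δ12₀ − δ12₃)`
(`facts347_exp261_geo9Y`), row sum at rate 1 (`rowSum261_geo9Y`), `pX0_of_pins` (w6), `gQs1_pinsB ∕ pXQs_pinsB` (w5 twins).
[cite: Balaban1985BackgroundPropagators, Thm 3.12 pp.421–423, Thm 3.13 p.426, (3.126) p.420, (3.153) p.426, (3.40)+(3.42)–(3.43) pp.397–398, p.398 (remark after (3.47)), (3.13) p.393; Balaban1984PropagatorsII, (2.52)–(2.56) pp.232–233, Lemma 2.1 (2.59)–(2.61) pp.233–234] -/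
theorem g0qstar_transfer_letters_of_pins (θ : Stage3Params) (Mstar : ℕ) {R₁ R₂ : RegFamY θ.d₆ θ.ℓ₆ θ.hd' θ.hL' θ.b₀ θ.b₁ Mstar (Matrix (Fin N) (Fin N) ℂ)} {c : ℝ}
    (hGR : MemOfFam (specialUnitaryUnits (Fin N)) R₁)
    [∀ x : MemberY θ.d₆ θ.ℓ₆ θ.hd' θ.hL' θ.b₀ θ.b₁ Mstar, Fintype (geo9Y x).Site]
    (bI : ∀ x : MemberY θ.d₆ θ.ℓ₆ θ.hd' θ.hL' θ.b₀ θ.b₁ Mstar, FBondY x.toKIdx → IBondY x.toKIdx)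
    (hlev : ∀ (x : MemberY θ.d₆ θ.ℓ₆ θ.hd' θ.hL' θ.b₀ θ.b₁ Mstar) (f : FBondY x.toKIdx), lvl x.hN x.D x.hk (bI x f) = (blkV1 x.hN x.D f).1.1)
    (hβ1 : ∀ (x : MemberY θ.d₆ θ.ℓ₆ θ.hd' θ.hL' θ.b₀ θ.b₁ Mstar) (f : FBondY x.toKIdx), (geomT x.D).dist (β x.hN x.D x.hk (bI x f)) (blkV1 x.hN x.D f) ≤ 1)
    (H12 : MemberY θ.d₆ θ.ℓ₆ θ.hd' θ.hL' θ.b₀ θ.b₁ Mstar → Prop) {W12 : MemberY θ.d₆ θ.ℓ₆ θ.hd' θ.hL' θ.b₀ θ.b₁ Mstar → Type} [∀ x, Fintype (W12 x)]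
    (𝔬12 : ∀ x : MemberY θ.d₆ θ.ℓ₆ θ.hd' θ.hL' θ.b₀ θ.b₁ Mstar, B9Thm312Whole.Ops (geo9Y x) (bg9YR (Matrix (Fin N) (Fin N) ℂ) (specialUnitaryUnits (Fin N)) R₁ R₂ x) (XBK (TrIdx N) x.toKIdx) (XBK (TrIdx N) x.toKIdx) (XHK (TrIdx N) x.toKIdx) (W12 x))
    (𝔭A : ∀ x : MemberY θ.d₆ θ.ℓ₆ θ.hd' θ.hL' θ.b₀ θ.b₁ Mstar, HolderProbes (geo9Y x) (bg9YR (Matrix (Fin N) (Fin N) ℂ) (specialUnitaryUnits (Fin N)) R₁ R₂ x) (XBK (TrIdx N) x.toKIdx) (XBK (TrIdx N) x.toKIdx) (PK (FBondY x.toKIdx) (Fin (θ.d₆ + 1)) (TrIdx N)) (PK (FBondY x.toKIdx) (Fin (θ.d₆ + 1)) (TrIdx N)))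
    (parB : ∀ x : MemberY θ.d₆ θ.ℓ₆ θ.hd' θ.hL' θ.b₀ θ.b₁ Mstar, BondParY (Matrix (Fin N) (Fin N) ℂ) x.toKIdx) (hparB : ∀ x : MemberY θ.d₆ θ.ℓ₆ θ.hd' θ.hL' θ.b₀ θ.b₁ Mstar, parB x = parBY x.toKIdx)
    (h𝔭A : ∀ x : MemberY θ.d₆ θ.ℓ₆ θ.hd' θ.hL' θ.b₀ θ.b₁ Mstar, 𝔭A x = holderProbesKA x.toKIdx (trBasis N) (bg9YR (Matrix (Fin N) (Fin N) ℂ) (specialUnitaryUnits (Fin N)) R₁ R₂ x) (fun U => U) (parB x) (bI x))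
    (Dd : ∀ x : MemberY θ.d₆ θ.ℓ₆ θ.hd' θ.hL' θ.b₀ θ.b₁ Mstar, (bg9YR (Matrix (Fin N) (Fin N) ℂ) (specialUnitaryUnits (Fin N)) R₁ R₂ x).Cfg → Fin (θ.d₆ + 1) → Module.End ℝ (XBK (TrIdx N) x.toKIdx → ℝ))
    (hDd : ∀ (x : MemberY θ.d₆ θ.ℓ₆ θ.hd' θ.hL' θ.b₀ θ.b₁ Mstar) (U : (bg9YR (Matrix (Fin N) (Fin N) ℂ) (specialUnitaryUnits (Fin N)) R₁ R₂ x).Cfg), Dd x U = fun μ => coordOpK (trBasis N) (fun _ : Fin (θ.d₆ + 1) => cdBₗ x.toKIdx U μ))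
    (hblk12 : ∀ x : MemberY θ.d₆ θ.ℓ₆ θ.hd' θ.hL' θ.b₀ θ.b₁ Mstar, (𝔬12 x).blk = blkBK x.toKIdx (bI x)) (hblkZ12 : ∀ x : MemberY θ.d₆ θ.ℓ₆ θ.hd' θ.hL' θ.b₀ θ.b₁ Mstar, (𝔬12 x).blkZ = blkHK x.toKIdx)
    (hQsco12 : ∀ (x : MemberY θ.d₆ θ.ℓ₆ θ.hd' θ.hL' θ.b₀ θ.b₁ Mstar) (U : (bg9YR (Matrix (Fin N) (Fin N) ℂ) (specialUnitaryUnits (Fin N)) R₁ R₂ x).Cfg), (𝔬12 x).Qstar U = QscoKH x.toKIdx (trBasis N) (bg9YR (Matrix (Fin N) (Fin N) ℂ) (specialUnitaryUnits (Fin N)) R₁ R₂ x) (fun U => U) (parBY x.toKIdx) U)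
    {M12 a12 B12₀ δ12₀ δ12₃ : ℝ} (hB12₀ : 0 ≤ B12₀) (hδ30 : 0 ≤ δ12₃) (hδ₃₀ : δ12₃ < δ12₀)
    (he0 : ∀ x : MemberY θ.d₆ θ.ℓ₆ θ.hd' θ.hL' θ.b₀ θ.b₁ Mstar, M12 ≤ (geo9Y x).M → ∀ α₀ : ℝ, 0 < α₀ → (geo9Y x).M * α₀ ≤ a12 → ∀ U : (bg9YR (Matrix (Fin N) (Fin N) ℂ) (specialUnitaryUnits (Fin N)) R₁ R₂ x).Cfg, (bg9YR (Matrix (Fin N) (Fin N) ℂ) (specialUnitaryUnits (Fin N)) R₁ R₂ x).Reg335 c α₀ U →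
      (bg9YR (Matrix (Fin N) (Fin N) ℂ) (specialUnitaryUnits (Fin N)) R₁ R₂ x).Reg336 c α₀ U → HasMajorant (g := toB6 (geo9Y x) 1 (H12 x)) (𝔬12 x).blk ((𝔬12 x).G0 U)
      (fun (a b : (geo9Y x).Site) => B12₀ * (geo9Y x).len a ^ 2 * Real.exp (-(δ12₀ * (geo9Y x).dist a b))))
    (he1d : ∀ x : MemberY θ.d₆ θ.ℓ₆ θ.hd' θ.hL' θ.b₀ θ.b₁ Mstar, M12 ≤ (geo9Y x).M → ∀ α₀ : ℝ, 0 < α₀ → (geo9Y x).M * α₀ ≤ a12 → ∀ U : (bg9YR (Matrix (Fin N) (Fin N) ℂ) (specialUnitaryUnits (Fin N)) R₁ R₂ x).Cfg, (bg9YR (Matrix (Fin N) (Fin N) ℂ) (specialUnitaryUnits (Fin N)) R₁ R₂ x).Reg335 c α₀ U →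
      (bg9YR (Matrix (Fin N) (Fin N) ℂ) (specialUnitaryUnits (Fin N)) R₁ R₂ x).Reg336 c α₀ U → ∀ ν : Fin (θ.d₆ + 1), HasMajorantHom (g := toB6 (geo9Y x) 1 (H12 x)) (𝔬12 x).blk (𝔬12 x).blk (Dd x U ν ∘ₗ (𝔬12 x).G0 U)
      (fun (a b : (geo9Y x).Site) => B12₀ * (geo9Y x).len a * Real.exp (-(δ12₀ * (geo9Y x).dist a b)))) :
    ∃ (Mz Bz Bxz : ℝ), M12 ≤ Mz ∧ 0 ≤ Bz ∧ 0 ≤ Bxz ∧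
      ∀ x : MemberY θ.d₆ θ.ℓ₆ θ.hd' θ.hL' θ.b₀ θ.b₁ Mstar, Mz ≤ (geo9Y x).M → ∀ α₀ : ℝ, 0 < α₀ → (geo9Y x).M * α₀ ≤ a12 → ∀ U : (bg9YR (Matrix (Fin N) (Fin N) ℂ) (specialUnitaryUnits (Fin N)) R₁ R₂ x).Cfg, (bg9YR (Matrix (Fin N) (Fin N) ℂ) (specialUnitaryUnits (Fin N)) R₁ R₂ x).Reg335 c α₀ U → (bg9YR (Matrix (Fin N) (Fin N) ℂ) (specialUnitaryUnits (Fin N)) R₁ R₂ x).Reg336 c α₀ U →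
        HasMaj (weightNorm (BlockNorm.ofBlocks (toB6 (geo9Y x) 1 (H12 x)) (𝔬12 x).blkZ) (fun y => (geo9Y x).len y * (fun y => ((((θ.ℓ₆ + 1 : ℕ) : ℝ) ^ (θ.d₆ + 1)) ^ lvl x.hN x.D x.hk y)⁻¹) y) (fun y => (mul_pos (geo9Y_len_pos x y) (plateau_pos x.toKIdx y)).le)) (cNorm 1 (H12 x) (𝔬12 x).blk (fun y => (geo9Y_len_pos x y).le) 1)
          ((𝔬12 x).G0 U ∘ₗ (𝔬12 x).Qstar U) (fun a b => Bz * Real.exp (-(δ12₃ * (geo9Y x).dist a b))) ∧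
        (∀ β : ℝ, 0 ≤ β → β < 1 →
          HasMaj (weightNorm (BlockNorm.ofBlocks (toB6 (geo9Y x) 1 (H12 x)) (𝔬12 x).blkZ) (fun y => (geo9Y x).len y * (fun y => ((((θ.ℓ₆ + 1 : ℕ) : ℝ) ^ (θ.d₆ + 1)) ^ lvl x.hN x.D x.hk y)⁻¹) y) (fun y => (mul_pos (geo9Y_len_pos x y) (plateau_pos x.toKIdx y)).le)) (cNormR 1 (H12 x) (𝔭A x).blkPX (fun y => (geo9Y_len_pos x y).le) (β - 1))
            (((𝔭A x).ΦX U β ∘ₗ (𝔬12 x).G0 U) ∘ₗ (𝔬12 x).Qstar U) (fun a b => Bxz * Real.exp (-(δ12₃ * (geo9Y x).dist a b)))) := by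
  -- the strict budget is the [4] (2.60) transfer gap: α := 1/2, δ_F := 2(δ12₀ − δ12₃) > 0, so that δ12₀ − α·δ_F = δ12₃
  have hδF : 0 < 2 * (δ12₀ - δ12₃) := by linarith
  obtain ⟨Mg, hFa⟩ := facts347_exp261_geo9Y (d := θ.d₆) (ℓ := θ.ℓ₆) (hd := θ.hd') (hL := θ.hL') (b₀ := θ.b₀) (b₁ := θ.b₁) (Mstar := Mstar) H12
    (α := 1 / 2) (by norm_num) (by norm_num) hδF
  -- a [4] (2.61) row sum at rate 1 (only its constant enters)
  obtain ⟨ML, cL, hrowL⟩ := rowSum261_geo9Y (d := θ.d₆) (ℓ := θ.ℓ₆) (hd := θ.hd') (hL := θ.hL') (b₀ := θ.b₀) (b₁ := θ.b₁) (Mstar := Mstar) 1 one_pos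
  have hrow : ∀ x : MemberY θ.d₆ θ.ℓ₆ θ.hd' θ.hL' θ.b₀ θ.b₁ Mstar, ML ≤ (geo9Y x).M → RowSum (toB6 (geo9Y x) 1 (H12 x)) 1 (max cL 0) := fun x hM y => (hrowL x hM y).trans (le_max_left _ _)
  -- the produced constants: E = e^{(δ12₀+1)(ℓ+4)}·c·L₀ (Q\*-letter at rate δ12₀+1, row-sum constant, transfer length L₀ = ℓ+1); CX0 = w6's probe-zero constant
  set E : ℝ := Real.exp ((δ12₀ + 1) * ((θ.ℓ₆ : ℝ) + 4)) * max cL 0 * ((θ.ℓ₆ + 1 : ℕ) : ℝ) with hEd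
  have hE0 : 0 ≤ E := mul_nonneg (mul_nonneg (Real.exp_nonneg _) (le_max_right _ _)) (Nat.cast_nonneg _)
  have hcB : 0 ≤ coordBound39 (trBasis N) := by unfold coordBound39; exact norm_nonneg _
  have hbB : 0 ≤ basisBound39 (trBasis N) := Finset.sum_nonneg fun _ _ => norm_nonneg _
  set CX0 : ℝ := (coordBound39 (trBasis N) * ((θ.d₆ : ℝ) + 1) * basisBound39 (trBasis N) * B12₀ * ((θ.ℓ₆ : ℝ) + 1) * Real.exp (δ12₀ * (((θ.d₆ : ℝ) + 1) * (((θ.ℓ₆ : ℝ) + 1) + 1) + 2)) +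
      B12₀ + coordBound39 (trBasis N) * basisBound39 (trBasis N) * B12₀) with hCX0
  have hCX00 : 0 ≤ CX0 := by rw [hCX0]; positivity
  have hδ00 : 0 ≤ δ12₀ := hδ30.trans hδ₃₀.le
  have hδQ : (0 : ℝ) ≤ δ12₀ + 1 := by linarith
  have hδ₃ : δ12₃ ≤ δ12₀ - 1 / 2 * (2 * (δ12₀ - δ12₃)) := by linarith
  refine ⟨max M12 (max ML Mg), B12₀ * E, CX0 * E, le_max_left _ _, mul_nonneg hB12₀ hE0, mul_nonneg hCX00 hE0, fun x hM α₀ hα ha U hU hU' => ?_⟩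
  letI : Fintype (geo9K x.toKIdx).Site := (inferInstance : Fintype (geo9Y x).Site)
  have hM12x : M12 ≤ (geo9Y x).M := (le_max_left _ _).trans hM
  have hMLx : ML ≤ (geo9Y x).M := ((le_max_left _ _).trans (le_max_right _ _)).trans hM
  have hMgx : Mg ≤ (geo9Y x).M := ((le_max_right _ _).trans (le_max_right _ _)).trans hM
  have hUG := mem_of_reg335R hGR x hU
  have hFax := hFa x hMgx
  have he0x := he0 x hM12x α₀ hα ha U hU hU'
  have he1dx := he1d x hM12x α₀ hα ha U hU hU'
  have hBz : B12₀ * Real.exp ((δ12₀ + 1) * ((θ.ℓ₆ : ℝ) + 4)) * max cL 0 * ((θ.ℓ₆ + 1 : ℕ) : ℝ) ≤ B12₀ * E := le_of_eq (by rw [hEd]; ring)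
  have hBx : ∀ β : ℝ, 0 ≤ β → β < 1 → (fun _ : ℝ => CX0) β * Real.exp ((δ12₀ + 1) * ((θ.ℓ₆ : ℝ) + 4)) * max cL 0 * ((θ.ℓ₆ + 1 : ℕ) : ℝ) ≤ (fun _ : ℝ => CX0 * E) β :=
    fun _ _ _ => le_of_eq (by simp only [hEd]; ring)
  -- «U is SU(N)-valued» ⇒ unitary-like bond variables (for w6's probe-zero face)
  have hUL : ∀ μ z, T4RelativeLadder.UnitaryLike (U μ z) := fun μ z => B9Eq3132TentKinetic.contractive_of_mem (specialUnitaryUnits_le_unitaryUnits (hUG μ z))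
  have hG : GeoOK (geo9Y x) := ⟨geo9Y_dist_triangle x, geo9Y_dist_comm x, geo9K_dist_nonneg x.toKIdx, geo9Y_len_pos x⟩
  -- the probe-zero face Φ^X_β∘G₀ : 𝔠⁽⁰⁾ → 𝔠_P^{(β−2)} at the cut pin carrier, constant CX0 for every β ≤ 1 (w6 `pX0_of_pins`)
  have hpX0 : ∀ β : ℝ, 0 ≤ β → β < 1 →
      HasMaj (cNormR 1 (H12 x) (𝔬12 x).blk (fun y => (geo9Y_len_pos x y).le) 0) (cNormR 1 (H12 x) (𝔭A x).blkPX (fun y => (geo9Y_len_pos x y).le) (β - 2))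
        ((𝔭A x).ΦX U β ∘ₗ (𝔬12 x).G0 U) (fun a b => (fun _ : ℝ => CX0) β * Real.exp (-(δ12₀ * (geo9Y x).dist a b))) := fun β _ hβ1' =>
    pX0_of_pins (B := (bg9YR (Matrix (Fin N) (Fin N) ℂ) (specialUnitaryUnits (Fin N)) R₁ R₂ x)) x.toKIdx (trBasis N) hG (fun U => U) (hparB x) U hUL (hlev x) (hβ1 x) (h𝔭A x) (hblk12 x) (hDd x U)
      (fun y => (geo9Y_len_pos x y).le) ((𝔬12 x).G0 U) hB12₀ hδ00 he0x he1dx hβ1'.le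
  exact ⟨gQs1_pinsB x (hβ1 x) (B := (bg9YR (Matrix (Fin N) (Fin N) ℂ) (specialUnitaryUnits (Fin N)) R₁ R₂ x)) (cfg := fun U => U) (𝔬 := 𝔬12 x) (H := H12 x) hFax (B₀ := B12₀) (δ₀ := δ12₀) (σ := 1) (c := max cL 0) (δ₁ := δ12₀) (δ₃ := δ12₃)
      (δQ := δ12₀ + 1) (B₃ := B12₀ * E) (U := U) hUG (hrow x hMLx) (le_max_right _ _) hB12₀ hδQ hδ00 le_rfl le_rfl hδ₃ hBz (hblk12 x) (hblkZ12 x) (hQsco12 x U) he0x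
      (fun y => (plateau_pos x.toKIdx y).le) (fun y => (mul_pos (geo9Y_len_pos x y) (plateau_pos x.toKIdx y)).le),
    pXQs_pinsB x (hβ1 x) (B := (bg9YR (Matrix (Fin N) (Fin N) ℂ) (specialUnitaryUnits (Fin N)) R₁ R₂ x)) (cfg := fun U => U) (𝔬 := 𝔬12 x) (𝔭 := 𝔭A x) (H := H12 x) hFax (Bx0 := fun _ => CX0) (Bx := fun _ => CX0 * E) (δ₀ := δ12₀) (σ := 1)
      (c := max cL 0) (δ₁ := δ12₀) (δ₃ := δ12₃) (δQ := δ12₀ + 1) (U := U) hUG (hrow x hMLx) (le_max_right _ _) (fun _ _ _ => hCX00) hδQ hδ00 le_rfl le_rfl hδ₃ hBx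
      (hblk12 x) (hblkZ12 x) (hQsco12 x U) hpX0 (fun y => (plateau_pos x.toKIdx y).le) (fun y => (mul_pos (geo9Y_len_pos x y) (plateau_pos x.toKIdx y)).le)⟩

end Summit.QuantumFields.YangMills.BalabanUVNodes.N06G0QstarTransferLegAtPinsPU

end
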